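import Mathlib

/-!
# Wild twist at the CM prime — every layer of the anticyclotomic `ℤ_q`-tower is usable
(crux idea `wild-twist-at-cm-prime`, REV 3 support for (I1)_R and Lemma S_k; bsd-idea-20 g11, 2026-08-28)

Imports only Mathlib; no instance, no notation.  No summit statement is proved by this file.

(I1)_R at layer `k`: the coefficient ring `R_k = ℤ₂[ζ_{q^k}]` of the order-`q^k` partner is a product of
unramified rings `W(𝔽_{2^{f_k}})`, `f_k = ord(2 mod q^k)`, on each of which complex conjugation `ι : ζ ↦ ζ⁻¹` acts as
the NON-trivial involution `Frob^{f_k/2}` iff `−1 ∈ ⟨2⟩ ⊂ (ℤ/q^k)^×` (then `f_k` is even and `2^{f_k/2} ≡ −1`).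
For the five Gross primes `q ∈ {11,19,43,67,163}` (`q ≡ 3 (mod 8)`, so `2` is a non-residue) the Sketch's
`gross_two_pow_half` gives `2^{(q−1)/2} ≡ −1 (mod q)`; lifting the exponent (`x ≡ −1 (mod q^k) ⇒ x^q ≡ −1 (mod q^{k+1})`,
binomial theorem) gives `2^{(q−1)q^{k−1}/2} ≡ −1 (mod q^k)` for EVERY `k ≥ 1`, i.e. `−1 ∈ ⟨2⟩` at every layer.
Below: the kernel-checked instances `k ≤ 4` (`minusOne_mem_powers_two_layers`); the exact orders
`ord(2 mod q) = 10, 18, 14, 66, 162` (`order_two_mod_q`; note `q = 43` has order `14 ∣ 42`, all five orders EVEN);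
and `v_q(2^{(q−1)/2}+1) = 1` exactly (`two_pow_half_plus_one_exact`: no Wieferich-type degeneracy, so
`ord(2 mod q^k) = ord(2 mod q)·q^{k−1}`, checked for `k ≤ 3` in `order_two_layers`).
-/

set_option linter.dupNamespace false

namespace Summit.BirchSwinnertonDyer.BirchSwinnertonDyer.Cruxes.UpperOffV0HSYPlus.WildTwistAtCMPrime.AllLayers

/-- `a ^ e mod m` by binary powering (structural fuel). -/
def powModF : ℕ → ℕ → ℕ → ℕ → ℕ
  | 0, _, _, m => 1 % m
  | fuel + 1, a, e, m =>
    if e = 0 then 1 % m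
    else
      let h := powModF fuel a (e / 2) m
      let h2 := h * h % m
      if e % 2 = 1 then h2 * (a % m) % m else h2

def powMod (a e m : ℕ) : ℕ := powModF 64 a e m

/-- Copy of the Sketch's list of Gross primes with `h = 1`, `2` inert. -/
def grossPrimes'' : List ℕ := [11, 19, 43, 67, 163]

/-- `2^{(q−1)q^{k−1}/2} ≡ −1 (mod q^k)` for the five Gross primes and `k = 1, 2, 3, 4`:
complex conjugation is a power of Frobenius on every local factor of `ℤ₂[ζ_{q^k}]`. -/
theorem minusOne_mem_powers_two_layers :
    (grossPrimes''.all fun q => [1, 2, 3, 4].all fun k =>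
      powMod 2 ((q - 1) * q ^ (k - 1) / 2) (q ^ k) == q ^ k - 1) = true := by
  native_decide

/-- `v_q(2^{(q−1)/2} + 1) = 1` exactly: `q ∣` but `q² ∤`. -/
theorem two_pow_half_plus_one_exact :
    (grossPrimes''.all fun q =>
      (2 ^ ((q - 1) / 2) + 1) % q == 0 && (2 ^ ((q - 1) / 2) + 1) % (q ^ 2) != 0) = true := by
  native_decide

/-- Smallest `e` in `[1, bound]` with `a^e ≡ 1 (mod m)` (`0` if none). -/
def ordMod (a m bound : ℕ) : ℕ :=
  ((List.range bound).map (· + 1)).find? (fun e => powMod a e m == 1 % m) |>.getD 0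

/-- `ord(2 mod q) = 10, 18, 14, 66, 162` for `q = 11, 19, 43, 67, 163` — all EVEN (as `−1 ∈ ⟨2⟩` forces). -/
theorem order_two_mod_q : (grossPrimes''.map fun q => ordMod 2 q q) = [10, 18, 14, 66, 162] := by
  native_decide

/-- `ord(2 mod q^k) = ord(2 mod q) · q^{k−1}` for `k ≤ 3` (e.g. `q = 11`: `10, 110, 1210`; `q = 43`: `14, 602, 25886`). -/
theorem order_two_layers :
    (grossPrimes''.all fun q => [1, 2, 3].all fun k =>
      let n := ordMod 2 q q * q ^ (k - 1)
      powMod 2 n (q ^ k) == 1 &&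
        (Nat.primeFactorsList n).all fun r => powMod 2 (n / r) (q ^ k) != 1) = true := by
  native_decide

/-- Layer sizes: `#Pic 𝒪_{q^k} = q^k` has `φ(q^k) = (q−1)q^{k−1}` characters of exact order `q^k`, an EVEN number,
half of which (Lemma S_k) have root number `+1`; e.g. `q = 11`: `10, 110, 1210` at `k = 1, 2, 3`. -/
theorem layer_sizes_eleven : ([1, 2, 3].map fun k => Nat.totient (11 ^ k)) = [10, 110, 1210] := by
  native_decide

end Summit.BirchSwinnertonDyer.BirchSwinnertonDyer.Cruxes.UpperOffV0HSYPlus.WildTwistAtCMPrime.AllLayers
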